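import Summits.QuantumFields.BalabanUV.Beta.FP.NestedDressingProjectorBounds
import Summits.QuantumFields.BalabanUV.Beta.SymmetrisedDressingKernel
import Summits.QuantumFields.BalabanUV.Beta.HessKerDressedUnits

/-!
# `BalabanUV.Beta.FP.NestedDressingKernel` — road «FP» for binder row D1, R-FP-45 (B), row NESTED-DRESS, FILE 4: THE KERNELISATION —
# the matrix `pmSymNest ρ Lc m β p α q := (Π^{(m)}_nest δ_{(α,q)})_β(p)` (window `p − q ∈ cube (Lc^m)`, bound `1 + 4·n·(m·Lc^m)`, `Lc^m`-block translation
# covariance, `m = 1` = an2's `pmSymBm`) and the projector KERNEL `piKSymNest ρ Lc m : MKer (d+1) (Fib d)` in an2's `piKSymBm` shape (field block the windowed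
# matrix, multiplier block the identity) with **`decays_piKSymNest`: `Decays (piKSymNest (toSite r) Lc m) (cPbNest d Lc m δ) δ` AT EVERY RATE `δ ≥ 0`** — the
# `∃`-`Decays` letter leaf-02's `FP/PerfectSecondOrderTablesDressed` takes as its only hypothesis on the dressing kernel `P`

HONEST DEPENDENCY (page 1, mandatory): continuum YM on T⁴ ⇐ BetaPertH ∧ nine spine estimates (0/9 proved); BetaPertH ⇐ (D1) ∧ (D4) ∧ CAP+tail;
G-an2-4 gates asym, D1 and NE2/3/4.  HONEST FRAMING (cell contract, verbatim): «discharging `BetaPertH` makes Bałaban's UV stability UNCONDITIONAL —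
a real constructive-QFT result; it is NOT the continuum limit and NOT the Clay problem.»  THIS MODULE DISCHARGES NOTHING of the wall: [folklore] finite sums
on `ℤ^n` ∕ `ℤ^{d+1}`; THREE definitions (`pmSymNest`, `cPbNest`, `piKSymNest` — [our object], the kernel form of the row's projector), no `def … : Prop`, nothing
cited, 0 sorry; 0∕4 row-D1 binders; NOT SDF, NOT D1, NOT BetaPertH, NOT continuum, NOT Clay.  «not in print; our bookkeeping».

ABSOLUTE RULE (cell charter, verbatim): «No internally-minted statement may enter as a cited fact. Every hypothesis is either kernel-proved in this package or a
verbatim quotation of a PUBLISHED theorem with page reference. The manuscript(s) under audit are NOT citable for their own disputed steps — they are the thing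
under adjudication; programme-internal (2001/route/tribunal) claims are never citable.»

WHY (RULING R-FP-45 l.33687 (B): `S j m := Π^{(m)}_nestᵀ·S_j·Π^{(m)}_nest`, `Wt j m` likewise, in an2's `dressKSymAt` shape `comp (comp P K) (trK P)`; leaf-02's
INTENT 2 l.33854 takes `P` as a parameter with ONLY `∃ δ C, 0 < δ ∧ 0 ≤ C ∧ Decays P C δ`; asym1 W-asym1-g87-1 (b): «finite range + operator bound ⇒ Decays at every
rate»).  FILES 1–3 gave the projector at the Form level with its exact `Lc^m`-block window and its sup bound; this file packages them as a KERNEL exactly as an2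
packaged `Π̂_bm` (`SymmetrisedDressingMatrix` → `SymmetrisedDressingKernel`), so every consumer written against `piKSymBm` re-instantiates verbatim at `piKSymNest`.

CONTENTS ([folklore]; generic `n` for the matrix, `d+1` for the kernel; in-block root `r ∈ box`, `1 ≤ Lc`):
* §1 `Lc^m`-BLOCK TRANSLATION COVARIANCE at the Form level: `qbar_shift`, `symBmGaugeAt_shift`, **`symNestGaugeAt_shift`**, **`symAxProjNestAt_shift`**
  (`Π^{(m)} (shift (Lc^m•v) A) β p = Π^{(m)} A β (p + Lc^m•v)`).
* §2 [our object] `pmSymNest`; `pmSymNest_one` (= `pmSymBm ρ Lc`), **`abs_pmSymNest_le`** (`≤ 1 + 4·n·(m·Lc^m)`), **`window_of_pmSymNest_ne_zero`** (`p − q ∈ cube n (Lc^m)`),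
  **`pmSymNest_shift`**.
* §3 [our object] `cPbNest d Lc m δ := (1 + 4·(d+1)·(m·Lc^m))·exp(δ·(d+1)·Lc^m)` (`_nonneg`, `one_le_`), [our object] **`piKSymNest`** (entries `_inl_inl ∕ _inl_inr ∕ _inr_inl ∕ _inr_inr`,
  `piKSymNest_inl_inl_eq`, **`piKSymNest_one : piKSymNest (toSite r) Lc 1 = piKSymBm (toSite r) Lc`**), **`decays_piKSymNest`** (every rate), `spr_piKSymNest`, `spr_trK_piKSymNest`,
  `exists_decays_piKSymNest` (leaf-02's letter shape), **`shiftK_piKSymNest`** (`shiftK (−(Lc^m•t))`-invariance).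
* §4 THE UNITS LETTER `hPu` (asym1 W-asym1-g87-1 (c), `hessKer_dressWith_unit` shape): `comp_scaleK_of_comm` ∕ `scaleK_comp_of_comm` (a fibrewise rescaling passes through a
  kernel that commutes with it), `piKSymNest_legScale_comm`, **`dressNest_unitK : comp (comp (piKSymNest ρ Lc m) (unitK sf sm K)) (trK (piKSymNest ρ Lc m)) =
  unitK sf sm (comp (comp (piKSymNest ρ Lc m) K) (trK (piKSymNest ρ Lc m)))`** (leg-TYPE-constant units commute with the leg-type-diagonal dressing).
NOT HERE: permutation ∕ reflection covariance
(needs the centred root and an2's `symAxProjBmAt_ctr_P1` lifted through `qbar`), the dressing functor instances (`S j m`, `Wt j m`) — leaf-02 ∕ owner rows.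
Provenance: road FP swarm LEAF PROVER `b2b-balaban-beta-d1-formalise-leaf-06` gen 14, 2026-08-21, row NESTED-DRESS (owner assignment l.33213; GO l.33582; name reserved
W-d1leaf06g14-4 l.33880).  Names PROVISIONAL.
-/

noncomputable section

open Finset
open scoped BigOperators Nat
open Literature.MathematicalPhysics.QuantumFieldTheory
open Literature.MathematicalPhysics.QuantumFieldTheory.Balaban1983to89
open Literature.MathematicalPhysics.QuantumFieldTheory.Balaban1983to89.Beta
open B12Sec2to5 (l1 l1_nonneg)
open ExpKernelCalculus (MKer Decays comp shiftK l1_sub_symm)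
open HessKerRate (scaleK scaleK_apply)
open Summit.QuantumFields.BalabanUV.Beta.HessKerDressedUnits (legScale legScale_inl legScale_inr unitK unitK_apply)
open AffineAveraging (Form0 Form1 Site unitVec unitVec_apply dz box toSite blockSum contourSum)
open AffineReproduction (contourSum_trans1 trans1)
open AveragingContours (grad blk blk_block shift)
open AxialProjector (blk_add_zsmul)
open OneStepResolventKernel (Fib)
open Summit.QuantumFields.BalabanUV.Beta.TameKernelCalculus (Spr trK Spr.trK)
open Summit.QuantumFields.BalabanUV.Beta.AxialProjectorBlockMean (blockMeanAt)
open Summit.QuantumFields.BalabanUV.Beta.AxialDressingRooted (cube mem_cube zero_mem_cube l1_le_of_mem_cube)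
open Summit.QuantumFields.BalabanUV.Beta.SymmetrisedAxialPotential (symTreeGaugeAt)
open Summit.QuantumFields.BalabanUV.Beta.SymmetrisedAxialGaugeBlockMean (symGaugeAt symBmGaugeAt symAxProjBmAt)
open Summit.QuantumFields.BalabanUV.Beta.SymmetrisedDressingMatrix (bondIndR bondIndR_apply bondIndR_shift pmSymBm symTreeGaugeAt_shift sub_mem_cube_of_blk_eq
  sub_mem_cube_of_blk_eq_succ)
open Summit.QuantumFields.BalabanUV.Beta.SymmetrisedDressingKernel (piKSymBm piKSymBm_inl_inl piKSymBm_inl_inr piKSymBm_inr_inl piKSymBm_inr_inr)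
open Summit.QuantumFields.BalabanUV.Beta.FP.NestedDressingProjector (qbar liftBlk symNestGaugeAt symAxProjNestAt symNestGaugeAt_zero_left symNestGaugeAt_succ
  symAxProjNestAt_one)
open Summit.QuantumFields.BalabanUV.Beta.FP.NestedDressingProjectorBounds (abs_symAxProjNestAt_le_of_sup symAxProjNestAt_apply_eq_zero_of_vanish)

namespace Summit.QuantumFields.BalabanUV.Beta.FP.NestedDressingKernel

/-! ## §1 `Lc^m`-block translation covariance (Form level, generic dimension) -/

section Shift

variable {n : ℕ}

/-- [folklore] The mean-normalised straight averaging is block-translation covariant: `𝒬̄_L (shift (L•w) A) = shift w (𝒬̄_L A)` (`contourSum_trans1`). -/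
theorem qbar_shift (L : ℕ) (w : Site n) (A : Form1 n ℝ) : qbar L (shift ((L : ℤ) • w) A) = shift w (qbar L A) := by
  funext κ y
  have h := congrFun (congrFun (contourSum_trans1 (N := L) w A) κ) y
  show (((L : ℝ) ^ n))⁻¹ * contourSum L (trans1 ((L : ℤ) • w) A) κ y = (((L : ℝ) ^ n))⁻¹ * contourSum L A κ (y + w)
  rw [h]
  rfl

/-- [folklore] … and its iterates: `𝒬̄_L^k (shift (L^k•w) A) = shift w (𝒬̄_L^k A)`. -/
theorem qbar_iterate_shift (L : ℕ) : ∀ (k : ℕ) (w : Site n) (A : Form1 n ℝ),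
    (qbar L)^[k] (shift (((L : ℤ) ^ k) • w) A) = shift w ((qbar L)^[k] A)
  | 0, w, A => by simp
  | k + 1, w, A => by
      rw [Function.iterate_succ_apply, Function.iterate_succ_apply, pow_succ', mul_smul, qbar_shift, qbar_iterate_shift L k]

/-- [folklore] The literal's one-step functional is block-translation covariant: `σ₁ (shift (N•v) A) x = σ₁ A (x + N•v)` (`N ≥ 1`; an2's `symTreeGaugeAt_shift`). -/
theorem symBmGaugeAt_shift (ρ : Site n) {N : ℕ} (hN : 1 ≤ N) (A : Form1 n ℝ) (v x : Site n) :
    symBmGaugeAt ρ (shift ((N : ℤ) • v) A) N x = symBmGaugeAt ρ A N (x + (N : ℤ) • v) := by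
  have hg : ∀ y, symGaugeAt ρ (shift ((N : ℤ) • v) A) N y = symGaugeAt ρ A N (y + (N : ℤ) • v) := by
    intro y; rw [symGaugeAt, symGaugeAt, symTreeGaugeAt_shift ρ hN]
  have hbm : ∀ y, blockMeanAt N (symGaugeAt ρ (shift ((N : ℤ) • v) A) N) y = blockMeanAt N (symGaugeAt ρ A N) (y + (N : ℤ) • v) := by
    intro y
    unfold blockMeanAt AffineAveraging.blockSum
    rw [blk_add_zsmul hN]
    congr 1
    refine Finset.sum_congr rfl fun b _ => ?_
    rw [hg]
    congr 1
    rw [smul_add]; abel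
  show symGaugeAt ρ (shift ((N : ℤ) • v) A) N x - blockMeanAt N (symGaugeAt ρ (shift ((N : ℤ) • v) A) N) x = 
    symGaugeAt ρ A N (x + (N : ℤ) • v) - blockMeanAt N (symGaugeAt ρ A N) (x + (N : ℤ) • v)
  rw [hg, hbm]

/-- [folklore] **THE NESTED FUNCTIONAL IS `Lc^m`-BLOCK TRANSLATION COVARIANT**: `σ^{(m)} (shift (Lc^m•v) A) x = σ^{(m)} A (x + Lc^m•v)` (`Lc ≥ 1`). -/
theorem symNestGaugeAt_shift (ρ : Site n) {Lc : ℕ} (hLc : 1 ≤ Lc) : ∀ (m : ℕ) (A : Form1 n ℝ) (v x : Site n),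
    symNestGaugeAt ρ Lc m (shift (((Lc : ℤ) ^ m) • v) A) x = symNestGaugeAt ρ Lc m A (x + ((Lc : ℤ) ^ m) • v)
  | 0, A, v, x => by rw [symNestGaugeAt_zero_left, symNestGaugeAt_zero_left]; rfl
  | m + 1, A, v, x => by
      have e1 : ((Lc : ℤ) ^ (m + 1)) • v = (Lc : ℤ) • (((Lc : ℤ) ^ m) • v) := by rw [pow_succ', mul_smul]
      rw [symNestGaugeAt_succ, symNestGaugeAt_succ, Pi.add_apply, Pi.add_apply, e1, symBmGaugeAt_shift ρ hLc, qbar_shift]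
      show _ + symNestGaugeAt ρ Lc m (shift (((Lc : ℤ) ^ m) • v) (qbar Lc A)) (blk Lc x)
        = _ + symNestGaugeAt ρ Lc m (qbar Lc A) (blk Lc (x + (Lc : ℤ) • (((Lc : ℤ) ^ m) • v)))
      rw [symNestGaugeAt_shift ρ hLc m, blk_add_zsmul hLc]

/-- [folklore] **THE NESTED PROJECTOR IS `Lc^m`-BLOCK TRANSLATION COVARIANT**: `(Π^{(m)} (shift (Lc^m•v) A))_β(p) = (Π^{(m)} A)_β(p + Lc^m•v)`. -/
theorem symAxProjNestAt_shift (ρ : Site n) {Lc : ℕ} (hLc : 1 ≤ Lc) (m : ℕ) (A : Form1 n ℝ) (v : Site n) (β : Fin n) (p : Site n) :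
    symAxProjNestAt ρ Lc m (shift (((Lc : ℤ) ^ m) • v) A) β p = symAxProjNestAt ρ Lc m A β (p + ((Lc : ℤ) ^ m) • v) := by
  simp only [symAxProjNestAt, Pi.sub_apply, grad, shift, symNestGaugeAt_shift ρ hLc]
  have e : p + unitVec β + ((Lc : ℤ) ^ m) • v = p + ((Lc : ℤ) ^ m) • v + unitVec β := by abel
  rw [e]

end Shift

/-! ## §2 The matrix `pmSymNest` of `Π^{(m)}_nest`: `m = 1`, bound, window, block translation -/

section Matrix

variable {n : ℕ}

/-- [our object] **THE MATRIX OF THE NESTED PROJECTOR**: `pmSymNest ρ Lc m β p α q := (Π^{(m)}_nest δ_{(α,q)})_β(p)` (cf. an2's `pmSymBm`). -/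
def pmSymNest (ρ : Fin n → ℤ) (Lc m : ℕ) (β : Fin n) (p : Fin n → ℤ) (α : Fin n) (q : Fin n → ℤ) : ℝ :=
  symAxProjNestAt ρ Lc m (bondIndR α q) β p

/-- [folklore] **`m = 1` IS THE LITERAL's MATRIX**: `pmSymNest ρ Lc 1 = pmSymBm ρ Lc`. -/
theorem pmSymNest_one (ρ : Fin n → ℤ) (Lc : ℕ) (β : Fin n) (p : Fin n → ℤ) (α : Fin n) (q : Fin n → ℤ) :
    pmSymNest ρ Lc 1 β p α q = pmSymBm ρ Lc β p α q := by
  rw [pmSymNest, symAxProjNestAt_one]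
  rfl

/-- [folklore] A bond indicator is sup-bounded by `1`. -/
theorem abs_bondIndR_le (α : Fin n) (q : Fin n → ℤ) (κ : Fin n) (z : Fin n → ℤ) : |bondIndR α q κ z| ≤ 1 := by
  rw [bondIndR_apply]; split <;> simp

/-- [folklore] **THE BOUND**: `|pmSymNest (toSite r) Lc m β p α q| ≤ 1 + 4·n·(m·Lc^m)` (in-block root, `Lc ≥ 1`). -/
theorem abs_pmSymNest_le {Lc : ℕ} (hLc : 1 ≤ Lc) {r : Fin n → ℕ} (hr : r ∈ box n Lc) (m : ℕ) (β : Fin n) (p : Fin n → ℤ) (α : Fin n)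
    (q : Fin n → ℤ) : |pmSymNest (toSite r) Lc m β p α q| ≤ 1 + 4 * (n : ℝ) * ((m : ℝ) * (Lc : ℝ) ^ m) := by
  have h := abs_symAxProjNestAt_le_of_sup hLc hr zero_le_one (abs_bondIndR_le α q) m β p
  rw [mul_one] at h
  exact h

/-- [folklore] **THE WINDOW**: `pmSymNest (toSite r) Lc m β p α q ≠ 0 → p − q ∈ cube n (Lc^m)` — the source bond is the target bond or lies inside one of the two
`Lc^m`-blocks met by it (FILE 3's `symAxProjNestAt_apply_eq_zero_of_vanish`). -/
theorem window_of_pmSymNest_ne_zero {Lc : ℕ} (hLc : 1 ≤ Lc) {r : Fin n → ℕ} (hr : r ∈ box n Lc) {m : ℕ} {β : Fin n} {p : Fin n → ℤ}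
    {α : Fin n} {q : Fin n → ℤ} (h : pmSymNest (toSite r) Lc m β p α q ≠ 0) : p - q ∈ cube n (Lc ^ m) := by
  have hLm : 1 ≤ Lc ^ m := Nat.one_le_pow _ _ hLc
  by_contra hw
  apply h
  refine symAxProjNestAt_apply_eq_zero_of_vanish hLc hr m β p ?_ ?_ ?_
  · rw [bondIndR_apply, if_neg]
    rintro ⟨-, rfl⟩
    exact hw (by rw [sub_self]; exact zero_mem_cube _)
  · intro κ' y hy _
    rw [bondIndR_apply, if_neg]
    rintro ⟨-, rfl⟩
    exact hw (sub_mem_cube_of_blk_eq hLm hy)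
  · intro κ' y hy _
    rw [bondIndR_apply, if_neg]
    rintro ⟨-, rfl⟩
    exact hw (sub_mem_cube_of_blk_eq_succ hLm hy)

/-- [folklore] **BLOCK TRANSLATION OF THE MATRIX** by `Lc^m`: `pmSymNest ρ Lc m β (p + Lc^m•z) α (q + Lc^m•z) = pmSymNest ρ Lc m β p α q`. -/
theorem pmSymNest_shift (ρ : Fin n → ℤ) {Lc : ℕ} (hLc : 1 ≤ Lc) (m : ℕ) (β : Fin n) (p : Fin n → ℤ) (α : Fin n) (q z : Fin n → ℤ) :
    pmSymNest ρ Lc m β (p + ((Lc : ℤ) ^ m) • z) α (q + ((Lc : ℤ) ^ m) • z) = pmSymNest ρ Lc m β p α q := by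
  have hneg : -(((Lc : ℤ) ^ m) • z) = ((Lc : ℤ) ^ m) • (-z) := by rw [smul_neg]
  rw [pmSymNest, pmSymNest, bondIndR_shift, hneg, symAxProjNestAt_shift ρ hLc]
  congr 1
  rw [smul_neg]; abel

end Matrix

/-! ## §3 The nested projector kernel `piKSymNest` and its decay at every rate -/

section Kernel

variable {d : ℕ}

/-- [our object] THE DECAY CONSTANT at rate `δ`: `(1 + 4·(d+1)·(m·Lc^m)) · e^{δ·(d+1)·Lc^m}` (cf. an2's `cPb`). -/
def cPbNest (d Lc m : ℕ) (δ : ℝ) : ℝ :=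
  (1 + 4 * (((d : ℝ) + 1) * ((m : ℝ) * (Lc : ℝ) ^ m))) * Real.exp (δ * (((d : ℝ) + 1) * (Lc : ℝ) ^ m))

/-- [folklore] `0 ≤ cPbNest`. -/
theorem cPbNest_nonneg (d Lc m : ℕ) (δ : ℝ) : 0 ≤ cPbNest d Lc m δ := by
  unfold cPbNest
  have : (0 : ℝ) ≤ ((d : ℝ) + 1) * ((m : ℝ) * (Lc : ℝ) ^ m) := by positivity
  exact mul_nonneg (by linarith) (Real.exp_pos _).le

/-- [folklore] `1 ≤ cPbNest` for `δ ≥ 0`. -/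
theorem one_le_cPbNest (d Lc m : ℕ) {δ : ℝ} (hδ : 0 ≤ δ) : 1 ≤ cPbNest d Lc m δ := by
  unfold cPbNest
  have h1 : (1 : ℝ) ≤ 1 + 4 * (((d : ℝ) + 1) * ((m : ℝ) * (Lc : ℝ) ^ m)) := by
    have : (0 : ℝ) ≤ ((d : ℝ) + 1) * ((m : ℝ) * (Lc : ℝ) ^ m) := by positivity
    linarith
  have h2 : (1 : ℝ) ≤ Real.exp (δ * (((d : ℝ) + 1) * (Lc : ℝ) ^ m)) := Real.one_le_exp (by positivity)
  nlinarith

/-- [our object] **THE NESTED PROJECTOR KERNEL** `piKSymNest ρ Lc m`: field block `[x′ − x ∈ cube (Lc^m)]·pmSymNest ρ Lc m β x′ α x`, multiplier block the identity —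
an2's `piKSymBm` with the nested matrix (so it represents `Π^{(m)ᵀ}_nest`, and `trK` of it `Π^{(m)}_nest`, in the cell's operator convention). -/
def piKSymNest (ρ : Fin (d + 1) → ℤ) (Lc m : ℕ) : MKer (d + 1) (Fib d) :=
  fun x x' a b =>
    match a, b with
    | Sum.inl α, Sum.inl β => if x' - x ∈ cube (d + 1) (Lc ^ m) then pmSymNest ρ Lc m β x' α x else 0
    | Sum.inl _, Sum.inr _ => 0
    | Sum.inr _, Sum.inl _ => 0
    | Sum.inr μ, Sum.inr μ' => if x = x' ∧ μ = μ' then 1 else 0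

variable (ρ : Fin (d + 1) → ℤ) (Lc m : ℕ)

/-- [folklore] Field–field entry. -/
theorem piKSymNest_inl_inl (x x' : Fin (d + 1) → ℤ) (α β : Fin (d + 1)) :
    piKSymNest ρ Lc m x x' (Sum.inl α) (Sum.inl β) = if x' - x ∈ cube (d + 1) (Lc ^ m) then pmSymNest ρ Lc m β x' α x else 0 := rfl

/-- [folklore] Field–multiplier entry. -/
theorem piKSymNest_inl_inr (x x' : Fin (d + 1) → ℤ) (α μ : Fin (d + 1)) : piKSymNest ρ Lc m x x' (Sum.inl α) (Sum.inr μ) = 0 := rfl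

/-- [folklore] Multiplier–field entry. -/
theorem piKSymNest_inr_inl (x x' : Fin (d + 1) → ℤ) (μ α : Fin (d + 1)) : piKSymNest ρ Lc m x x' (Sum.inr μ) (Sum.inl α) = 0 := rfl

/-- [folklore] Multiplier–multiplier entry (identity). -/
theorem piKSymNest_inr_inr (x x' : Fin (d + 1) → ℤ) (μ μ' : Fin (d + 1)) :
    piKSymNest ρ Lc m x x' (Sum.inr μ) (Sum.inr μ') = if x = x' ∧ μ = μ' then 1 else 0 := rfl

variable {ρ Lc m}

/-- [folklore] The window indicator is redundant (in-block root): the field–field entry IS the matrix element. -/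
theorem piKSymNest_inl_inl_eq {Lc : ℕ} (hLc : 1 ≤ Lc) {r : Fin (d + 1) → ℕ} (hr : r ∈ box (d + 1) Lc) (m : ℕ) (x x' : Fin (d + 1) → ℤ)
    (α β : Fin (d + 1)) : piKSymNest (toSite r) Lc m x x' (Sum.inl α) (Sum.inl β) = pmSymNest (toSite r) Lc m β x' α x := by
  rw [piKSymNest_inl_inl]
  split_ifs with h
  · rfl
  · by_contra h0
    exact h (window_of_pmSymNest_ne_zero hLc hr (Ne.symm h0))

/-- [folklore] **`m = 1` IS THE LITERAL's KERNEL**: `piKSymNest ρ Lc 1 = piKSymBm ρ Lc`. -/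
theorem piKSymNest_one (ρ : Fin (d + 1) → ℤ) (Lc : ℕ) : piKSymNest ρ Lc 1 = piKSymBm ρ Lc := by
  funext x x' a b
  rcases a with α | μ <;> rcases b with β | μ'
  · rw [piKSymNest_inl_inl, piKSymBm_inl_inl, pow_one, pmSymNest_one]
  · rfl
  · rfl
  · rfl

/-- [folklore] **`piKSymNest` DECAYS AT EVERY RATE** (in-block root, `Lc ≥ 1`): window `cube (Lc^m)` × bound `1 + 4·(d+1)·(m·Lc^m)` — asym1's «finite range + operator
bound ⇒ Decays at every rate», constant `cPbNest d Lc m δ` per `m`, uniform in the root and in any background. -/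
theorem decays_piKSymNest {Lc : ℕ} (hLc : 1 ≤ Lc) {r : Fin (d + 1) → ℕ} (hr : r ∈ box (d + 1) Lc) (m : ℕ) {δ : ℝ} (hδ : 0 ≤ δ) :
    Decays (piKSymNest (toSite r) Lc m) (cPbNest d Lc m δ) δ := by
  intro x x' a b
  have hpos : 0 ≤ cPbNest d Lc m δ * Real.exp (-δ * l1 (x - x')) := mul_nonneg (cPbNest_nonneg d Lc m δ) (Real.exp_pos _).le
  rcases a with α | μ <;> rcases b with β | μ'
  · rw [piKSymNest_inl_inl]
    split_ifs with h
    · have hl : l1 (x - x') ≤ ((d : ℝ) + 1) * (Lc : ℝ) ^ m := by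
        rw [l1_sub_symm]
        have := l1_le_of_mem_cube h
        push_cast at this
        exact this
      have hpm := abs_pmSymNest_le hLc hr m β x' α x
      have hdn : ((d + 1 : ℕ) : ℝ) = (d : ℝ) + 1 := by push_cast; ring
      rw [hdn] at hpm
      have hA : (0 : ℝ) ≤ 1 + 4 * (((d : ℝ) + 1) * ((m : ℝ) * (Lc : ℝ) ^ m)) := by
        have : (0 : ℝ) ≤ ((d : ℝ) + 1) * ((m : ℝ) * (Lc : ℝ) ^ m) := by positivity
        linarith
      have he : (1 : ℝ) ≤ Real.exp (δ * (((d : ℝ) + 1) * (Lc : ℝ) ^ m)) * Real.exp (-δ * l1 (x - x')) := by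
        rw [← Real.exp_add]
        exact Real.one_le_exp (by nlinarith)
      calc |pmSymNest (toSite r) Lc m β x' α x| ≤ (1 + 4 * (((d : ℝ) + 1) * ((m : ℝ) * (Lc : ℝ) ^ m))) * 1 := by
            rw [mul_one]; calc _ ≤ 1 + 4 * ((d : ℝ) + 1) * ((m : ℝ) * (Lc : ℝ) ^ m) := hpm
              _ = _ := by ring
        _ ≤ (1 + 4 * (((d : ℝ) + 1) * ((m : ℝ) * (Lc : ℝ) ^ m))) * (Real.exp (δ * (((d : ℝ) + 1) * (Lc : ℝ) ^ m)) * Real.exp (-δ * l1 (x - x'))) :=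
            mul_le_mul_of_nonneg_left he hA
        _ = cPbNest d Lc m δ * Real.exp (-δ * l1 (x - x')) := by unfold cPbNest; ring
    · rw [abs_zero]; exact hpos
  · rw [piKSymNest_inl_inr, abs_zero]; exact hpos
  · rw [piKSymNest_inr_inl, abs_zero]; exact hpos
  · rw [piKSymNest_inr_inr]
    split_ifs with h
    · rw [h.1, sub_self, abs_one]
      have h0 : l1 (0 : Fin (d + 1) → ℤ) = 0 := by simp [l1]
      rw [h0, mul_zero, Real.exp_zero, mul_one]
      exact one_le_cPbNest d Lc m hδ
    · rw [abs_zero]; exact hpos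

/-- [folklore] `piKSymNest` is spread. -/
theorem spr_piKSymNest {Lc : ℕ} (hLc : 1 ≤ Lc) {r : Fin (d + 1) → ℕ} (hr : r ∈ box (d + 1) Lc) (m : ℕ) : Spr (piKSymNest (toSite r) Lc m) :=
  ⟨cPbNest d Lc m 1, 1, one_pos, decays_piKSymNest hLc hr m zero_le_one⟩

/-- [folklore] So is its transpose. -/
theorem spr_trK_piKSymNest {Lc : ℕ} (hLc : 1 ≤ Lc) {r : Fin (d + 1) → ℕ} (hr : r ∈ box (d + 1) Lc) (m : ℕ) :
    Spr (trK (piKSymNest (toSite r) Lc m)) :=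
  (spr_piKSymNest hLc hr m).trK

/-- [folklore] **THE `∃`-`Decays` LETTER** in the shape leaf-02's `FP/PerfectSecondOrderTablesDressed` consumes (`∃ δ C, 0 < δ ∧ 0 ≤ C ∧ Decays P C δ`). -/
theorem exists_decays_piKSymNest {Lc : ℕ} (hLc : 1 ≤ Lc) {r : Fin (d + 1) → ℕ} (hr : r ∈ box (d + 1) Lc) (m : ℕ) :
    ∃ δ C : ℝ, 0 < δ ∧ 0 ≤ C ∧ Decays (piKSymNest (toSite r) Lc m) C δ :=
  ⟨1, cPbNest d Lc m 1, one_pos, cPbNest_nonneg d Lc m 1, decays_piKSymNest hLc hr m zero_le_one⟩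

/-- [folklore] **`piKSymNest` IS `Lc^m`-BLOCK-TRANSLATION INVARIANT**: `shiftK (−(Lc^m•t)) (piKSymNest ρ Lc m) = piKSymNest ρ Lc m` (`Lc ≥ 1`). -/
theorem shiftK_piKSymNest (ρ : Fin (d + 1) → ℤ) {Lc : ℕ} (hLc : 1 ≤ Lc) (m : ℕ) (t : Fin (d + 1) → ℤ) :
    shiftK (-(((Lc : ℤ) ^ m) • t)) (piKSymNest ρ Lc m) = piKSymNest ρ Lc m := by
  funext x x' a b
  show piKSymNest ρ Lc m (x + -(((Lc : ℤ) ^ m) • t)) (x' + -(((Lc : ℤ) ^ m) • t)) a b = piKSymNest ρ Lc m x x' a b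
  rcases a with α | μ <;> rcases b with β | μ'
  · rw [piKSymNest_inl_inl, piKSymNest_inl_inl, add_sub_add_right_eq_sub,
      show -(((Lc : ℤ) ^ m) • t) = ((Lc : ℤ) ^ m) • (-t) from (smul_neg _ _).symm, pmSymNest_shift ρ hLc]
  · rfl
  · rfl
  · rw [piKSymNest_inr_inr, piKSymNest_inr_inr]
    simp only [add_left_inj]

end Kernel


/-! ## §4 The units letter `hPu`: leg-type-constant rescalings commute with the nested dressing -/

section Units

variable {D : ℕ} {F : Type*} [Fintype F]

/-- [folklore] A fibrewise rescaling passes through a kernel that commutes with its left weight: `comp P (scaleK u v K) = scaleK u v (comp P K)` whenever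
`P x y a b · u b = u a · P x y a b`. (`tsum_mul_left ∕ _right` are unconditional over `ℝ`.) -/
theorem comp_scaleK_of_comm {P : MKer D F} {u : F → ℝ} (hP : ∀ x y a b, P x y a b * u b = u a * P x y a b) (v : F → ℝ) (K : MKer D F) :
    comp P (scaleK u v K) = scaleK u v (comp P K) := by
  funext x z a c
  simp only [comp, scaleK_apply]
  have e : ∀ (y : Fin D → ℤ) (f : F), P x y a f * (u f * K y z f c * v c) = u a * (P x y a f * K y z f c) * v c := by
    intro y f
    calc P x y a f * (u f * K y z f c * v c) = (P x y a f * u f) * K y z f c * v c := by ring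
      _ = u a * (P x y a f * K y z f c) * v c := by rw [hP]; ring
  simp only [e, ← Finset.sum_mul, ← Finset.mul_sum, tsum_mul_right, tsum_mul_left]

/-- [folklore] … and through a kernel that commutes with its right weight: `comp (scaleK u v M) Q = scaleK u v (comp M Q)` whenever `v f · Q y z f c = Q y z f c · v c`. -/
theorem scaleK_comp_of_comm {Q : MKer D F} {v : F → ℝ} (hQ : ∀ y z f c, v f * Q y z f c = Q y z f c * v c) (u : F → ℝ) (M : MKer D F) :
    comp (scaleK u v M) Q = scaleK u v (comp M Q) := by
  funext x z a c
  simp only [comp, scaleK_apply]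
  have e : ∀ (y : Fin D → ℤ) (f : F), u a * M x y a f * v f * Q y z f c = u a * (M x y a f * Q y z f c) * v c := by
    intro y f
    calc u a * M x y a f * v f * Q y z f c = u a * M x y a f * (v f * Q y z f c) := by ring
      _ = u a * (M x y a f * Q y z f c) * v c := by rw [hQ]; ring
  simp only [e, ← Finset.sum_mul, ← Finset.mul_sum, tsum_mul_right, tsum_mul_left]

end Units

section UnitsNest

variable {d : ℕ}

/-- [folklore] The nested projector kernel is LEG-TYPE DIAGONAL, so it commutes with the leg-type-constant units `legScale uf um`. -/
theorem piKSymNest_legScale_comm (ρ : Fin (d + 1) → ℤ) (Lc m : ℕ) (uf um : ℝ) (x y : Fin (d + 1) → ℤ) (a b : Fib d) :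
    piKSymNest ρ Lc m x y a b * legScale uf um b = legScale uf um a * piKSymNest ρ Lc m x y a b := by
  rcases a with α | μ <;> rcases b with β | μ'
  · rw [legScale_inl, legScale_inl, mul_comm]
  · rw [piKSymNest_inl_inr, zero_mul, mul_zero]
  · rw [piKSymNest_inr_inl, zero_mul, mul_zero]
  · rw [legScale_inr, legScale_inr, mul_comm]

/-- [folklore] **THE UNITS LETTER `hPu` FOR THE NESTED DRESSING**: the `piKSymNest`-dressing functor `K ↦ comp (comp P K) (trK P)` (an2's `dressKSymAt` shape) commutes
with asym1's leg-type-constant change of units `unitK uf um` — the hypothesis `hPu` of asym1's `hessKer_dressWith_unit` junction, at `Pn := dress^{(m)}_nest`. -/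
theorem dressNest_unitK (ρ : Fin (d + 1) → ℤ) (Lc m : ℕ) (uf um : ℝ) (K : MKer (d + 1) (Fib d)) :
    comp (comp (piKSymNest ρ Lc m) (unitK uf um K)) (trK (piKSymNest ρ Lc m)) =
      unitK uf um (comp (comp (piKSymNest ρ Lc m) K) (trK (piKSymNest ρ Lc m))) := by
  have e1 : unitK uf um K = scaleK (legScale uf um) (legScale uf um) K := rfl
  have e2 : ∀ M : MKer (d + 1) (Fib d), unitK uf um M = scaleK (legScale uf um) (legScale uf um) M := fun M => rfl
  rw [e1, comp_scaleK_of_comm (fun x y a b => piKSymNest_legScale_comm ρ Lc m uf um x y a b), e2,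
    scaleK_comp_of_comm (fun y z f c => ?_)]
  show legScale uf um f * piKSymNest ρ Lc m z y c f = piKSymNest ρ Lc m z y c f * legScale uf um c
  rw [mul_comm, piKSymNest_legScale_comm, mul_comm]

end UnitsNest

end Summit.QuantumFields.BalabanUV.Beta.FP.NestedDressingKernel

end
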